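import Summits.QuantumFields.YangMills.Theorems.BalabanUVNodesN15KingModelBoxImagesPrinted
import HarnessLib

/-!
# BalabanUVNodes ∕ N15 — THE KING-MODEL RUNG (PART Ε-i): UNIQUENESS OF THE FREE KERNEL — [Ba 4]'s «propagator with free boundary conditions on ξZ^d» (a = 0) is ONE object:
# every BOUNDED right (or left) inverse kernel of `c(−Δ)+m²` on ℤ^{d+1} is `K_∞(x − x′)`, the lattice Fourier integral of part Ε-a
# (Track A, DAG node N15 = NE2; FAN-OUT v1.1 §N15 s3 «KING-MODEL RUNG»; pv17 §7 `twoSided_inverse_unique` instantiated; count-neutral)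

HONEST FRAMING.  Count-neutral (cell `pub-ymgap`, seat `pub-ymgap-dag-n15-e` g40; `--supports stmt-QuantumFields-27366 --as helper` = K3⁸).
TEMPLATE LITERATURE: C. King, Commun. Math. Phys. **102** (1986) 649–677 [King1986], §4 p.670 l.8–13 («the operator defined by (2.13) with free boundary conditions (and A = 0, of
course)»); [Balaban1983RegularityDecay] = [Ba 4], p.584 (2.42)–(2.44) («the propagator G_j with free boundary conditions on ξZ^d»; «Defining the propagator G_j, φ₀ = G_j f»).
The cell's pv17 engine (`Literature…B4Reflection242` §7) proved, for [Ba 4]'s lattice operator `opK c₁ msq a b` in kernel form, that a two-sided inverse kernel of a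
finite-range operator with symmetric support is UNIQUE among kernels whose triple product converges absolutely (`twoSided_inverse_unique`: `G₂ = G₂(AG₁) = (G₂A)G₁ = G₁`,
Fubini on ℤ^{d+1}×ℤ^{d+1}), with absolute convergence for a bounded `G₂` and a decaying `G₁` (`summable_triple`).  Part Ε-a SUPPLIES the decaying inverse at `a = 0`, `b = 1`:
`K_∞(u − w)` (Green equation `freeKerC_green_opK` ∕ `_right` of part Ε-c, decay `norm_freeKerC_le`).  Hence:
★★★ **`freeKerC_unique_of_rightInverse`** — ANY bounded kernel `G` on ℤ^{d+1}×ℤ^{d+1} with `Σ_{z ∈ opSupp 1 x′} G(x,z)·opK c m² 0 1 z x′ = δ_{x,x′}` equals `K_∞(x − x′)`;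
★★★ **`freeKerC_unique_of_leftInverse`** — the same for bounded LEFT inverses (`Σ_z opK(x,z)G(z,x′) = δ`), through the transpose (`opK_comm`, `K_∞` even);
★★ **`freeKer_unique_of_leftInverse_real`** — real form for real kernels.  So the infinite-volume free covariance of this lineage (defined in Ε-a as a Fourier integral,
reached in Ε-f∕Ε-g as the thermodynamic limit with periodic OR free boundary conditions) is characterised intrinsically: the unique bounded Green kernel.

PRIOR TREE ART (used, not restated): pv17 `B4Reflection242` (`twoSided_inverse_unique`, `summable_triple`, `opK`, `opSupp`, `opK_eq_zero_of_not_mem`, `mem_opSupp_comm`, `opK_comm`),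
parts Ε-a (`freeKerC`, `norm_freeKerC_le`, `freeKerC_neg`, `ofReal_freeKer`), Ε-c (`freeKerC_green_opK`, `freeKerC_green_opK_right`).  NOT Bałaban's covariant objects; NOT a node
discharge (N15 is booked through n15-a's knit, untouched); nothing continuum-YM ∕ `ℝ⁴` ∕ OS ∕ Clay.  0 `sorry`, 0 `def`.

HONEST SCOPE.  `c ≥ 0`, `m² > 0`, any `d`; «bounded» = a uniform bound `‖G(u,w)‖ ≤ B`; no `ℓ²` operator theory is invoked (kernel identities only).  Locators: [King1986] §4 p.670
l.8–13, (2.13) p.653; [Balaban1983RegularityDecay] (2.42)–(2.44) p.584.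
-/

noncomputable section

open scoped BigOperators
open Finset Complex

namespace Summit.QuantumFields.YangMills.BalabanUVNodes.N15KingModelRung.TorusSpectral

open Literature.MathematicalPhysics.QuantumFieldTheory.Balaban1983to89.B4ContourShift (supNorm)
open Literature.MathematicalPhysics.QuantumFieldTheory.Balaban1983to89.B4Reflection242 (opK opSupp opK_eq_zero_of_not_mem mem_opSupp_comm opK_comm
  twoSided_inverse_unique summable_triple)

variable {d : ℕ} {c m2 : ℝ}

/-- ★★★ **UNIQUENESS AMONG BOUNDED RIGHT INVERSES**: if `‖G(u,w)‖ ≤ B` and `Σ_{z ∈ opSupp 1 x′} G(x,z)·opK c m² 0 1 z x′ = δ_{x,x′}` for all `x, x′ ∈ ℤ^{d+1}` (`c ≥ 0`, `m² > 0`), then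
`G(x,x′) = K_∞(x − x′)`. [cite: Balaban1983RegularityDecay, (2.42)–(2.44) p.584; King1986, §4 p.670 l.8–13] -/
theorem freeKerC_unique_of_rightInverse (hc : 0 ≤ c) (hm : 0 < m2) {G : (Fin (d + 1) → ℤ) → (Fin (d + 1) → ℤ) → ℂ} {B : ℝ}
    (hGB : ∀ u w, ‖G u w‖ ≤ B)
    (hR : ∀ x x', ∑ z ∈ opSupp 1 x', G x z * opK (c : ℂ) (m2 : ℂ) 0 1 z x' = if x = x' then 1 else 0)
    (x x' : Fin (d + 1) → ℤ) : G x x' = freeKerC c m2 (x - x') :=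
  twoSided_inverse_unique (opK (c : ℂ) (m2 : ℂ) 0 1) (fun u w => freeKerC c m2 (u - w)) G (opSupp 1)
    (fun _ _ hz => opK_eq_zero_of_not_mem le_rfl _ _ _ hz) (fun _ _ => mem_opSupp_comm le_rfl) (freeKerC_green_opK hc hm) hR
    (summable_triple le_rfl (c : ℂ) (m2 : ℂ) 0 (kappaFree_pos hc hm d) (by positivity : (0 : ℝ) ≤ 2 / m2)
      (fun u w => norm_freeKerC_le hc hm (u - w)) hGB) x x'

/-- ★★★ **UNIQUENESS AMONG BOUNDED LEFT INVERSES**: if `‖G(u,w)‖ ≤ B` and `Σ_{z ∈ opSupp 1 x} opK c m² 0 1 x z·G(z,x′) = δ_{x,x′}` for all `x, x′`, then `G(x,x′) = K_∞(x − x′)`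
(apply the right-inverse statement to the transposed kernel: `opK` is symmetric and `K_∞` is even). [cite: Balaban1983RegularityDecay, (2.42)–(2.44) p.584; King1986, §4 p.670 l.8–13] -/
theorem freeKerC_unique_of_leftInverse (hc : 0 ≤ c) (hm : 0 < m2) {G : (Fin (d + 1) → ℤ) → (Fin (d + 1) → ℤ) → ℂ} {B : ℝ}
    (hGB : ∀ u w, ‖G u w‖ ≤ B)
    (hL : ∀ x x', ∑ z ∈ opSupp 1 x, opK (c : ℂ) (m2 : ℂ) 0 1 x z * G z x' = if x = x' then 1 else 0)
    (x x' : Fin (d + 1) → ℤ) : G x x' = freeKerC c m2 (x - x') := by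
  -- the transposed kernel is a bounded right inverse
  have hR : ∀ y y', ∑ z ∈ opSupp 1 y', (fun u w => G w u) y z * opK (c : ℂ) (m2 : ℂ) 0 1 z y' = if y = y' then 1 else 0 := by
    intro y y'
    have h := hL y' y
    rw [show (if y = y' then (1 : ℂ) else 0) = if y' = y then 1 else 0 from if_congr eq_comm rfl rfl, ← h]
    exact Finset.sum_congr rfl fun z _ => by rw [opK_comm 1 (c : ℂ) (m2 : ℂ) 0 z y', mul_comm]
  have h := freeKerC_unique_of_rightInverse hc hm (G := fun u w => G w u) (fun u w => hGB w u) hR x' x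
  rw [← freeKerC_neg, neg_sub] at h
  exact h

/-- ★★ **TWO-SIDED FORM**: a bounded two-sided inverse kernel of `c(−Δ)+m²` on ℤ^{d+1} is `K_∞(· − ·)` — [Ba 4]'s «propagator with free boundary conditions on ξZ^d» at `a = 0` is
one well-defined kernel. [cite: Balaban1983RegularityDecay, (2.42)–(2.44) p.584; King1986, §4 p.670 l.8–13, (2.13) p.653] -/
theorem freeKerC_unique_of_twoSided (hc : 0 ≤ c) (hm : 0 < m2) {G : (Fin (d + 1) → ℤ) → (Fin (d + 1) → ℤ) → ℂ} {B : ℝ}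
    (hGB : ∀ u w, ‖G u w‖ ≤ B)
    (hL : ∀ x x', ∑ z ∈ opSupp 1 x, opK (c : ℂ) (m2 : ℂ) 0 1 x z * G z x' = if x = x' then 1 else 0)
    (_hR : ∀ x x', ∑ z ∈ opSupp 1 x', G x z * opK (c : ℂ) (m2 : ℂ) 0 1 z x' = if x = x' then 1 else 0) :
    G = fun x x' => freeKerC c m2 (x - x') :=
  funext fun x => funext fun x' => freeKerC_unique_of_leftInverse hc hm hGB hL x x'

/-- ★★ **REAL FORM**: a bounded real kernel `G` solving King's stencil equation `m²G(x,x′) + cΣ_μ(2G(x,x′) − G(x+e_μ,x′) − G(x−e_μ,x′)) = δ_{x,x′}` in the FIRST variable on all of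
ℤ^{d+1} is `K_∞(x − x′)`. [cite: King1986, (2.13) p.653, (4.4) p.670; Balaban1983RegularityDecay, (2.44) p.584] -/
theorem freeKer_unique_of_leftInverse_real (hc : 0 ≤ c) (hm : 0 < m2) {G : (Fin (d + 1) → ℤ) → (Fin (d + 1) → ℤ) → ℝ} {B : ℝ}
    (hGB : ∀ u w, |G u w| ≤ B)
    (hL : ∀ x x', m2 * G x x' + c * ∑ μ, (2 * G x x'
        - G (x + Literature.MathematicalPhysics.QuantumFieldTheory.Balaban1983to89.B4Green244.e μ) x'
        - G (x - Literature.MathematicalPhysics.QuantumFieldTheory.Balaban1983to89.B4Green244.e μ) x') = if x = x' then 1 else 0)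
    (x x' : Fin (d + 1) → ℤ) : G x x' = freeKer c m2 (x - x') := by
  -- complexify and read the stencil through pv17's kernel form
  have hGB' : ∀ u w, ‖((G u w : ℝ) : ℂ)‖ ≤ B := fun u w => by rw [Complex.norm_real, Real.norm_eq_abs]; exact hGB u w
  have hL' : ∀ y y', ∑ z ∈ opSupp 1 y, opK (c : ℂ) (m2 : ℂ) 0 1 y z * ((G z y' : ℝ) : ℂ) = if y = y' then 1 else 0 := by
    intro y y'
    rw [Literature.MathematicalPhysics.QuantumFieldTheory.Balaban1983to89.B4Green242Bridge.sum_opSupp_opK_mul le_rfl, zero_mul, add_zero, add_comm]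
    have h := congrArg (fun r : ℝ => (r : ℂ)) (hL y y')
    simp only [Literature.MathematicalPhysics.QuantumFieldTheory.Balaban1983to89.B4Green244.e] at h
    push_cast at h
    rw [h]
    split_ifs <;> simp
  have h := freeKerC_unique_of_leftInverse hc hm hGB' hL' x x'
  rw [← ofReal_freeKer] at h
  exact_mod_cast h

end Summit.QuantumFields.YangMills.BalabanUVNodes.N15KingModelRung.TorusSpectral

end
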